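import Literature.MathematicalPhysics.QuantumFieldTheory.Balaban1983to89.B9Eq3101ConjugationLettersChain

/-!
# `Balaban1983to89.B9Eq3101ConjugationLettersCoCurl` — T. Bałaban, *Propagators for lattice gauge theories in a background field*, Commun. Math. Phys.
# **99** (1985) 389–434 [Balaban1985BackgroundPropagators] (3.9) p. 392, (3.49) p. 399, (3.101)–(3.103) p. 414: **THE COMBES–THOMAS CONJUGATION LETTER
# OF THE COCURL `D*_U` (3.9) (plaquettes → bonds)** — `‖e^{κχ}·D*(e^{−κχ}F) − D*F‖ ≤ 4‖c‖‖κ‖θ·M_T·d^{3∕2}·‖F‖` for every transporter data bounded by `M_T`,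
# every cutoff with bond increments `≤ θ` in the window `‖κ‖θ ≤ 1` — the adjoint companion of the curl letter (`B9Eq3101ConjugationLettersCurl`), the last
# conjugation letter of the principal part `D*D` of (3.10) on the chain's carrier; stone (D0-a′) of the NE9 owner's plan v11

statement-level skeleton of published theorems with citation tags; proofs where landed; nothing here is a claim about the Yang–Mills mass gap

CITATION HEADER (lean-in-tree rule).  Audit cell `pub-balaban`, sub-cell `t4`, BINDER row NE9; filed by the NE9 BINDER-row OWNER lineage
`b2b-balaban-t4-ne9-p1` (gen 92).  Imports `B9Eq3101ConjugationLettersChain` (ne9-leaf-01; through it the scalar lemmas of `B9Eq3101ConjugationLetters` and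
`B9Eq310HessianOperator.covCoCurlL2K`).  Sources READ first-hand (`paper:balaban1985-cmp99-background-propagators`, journal page = PDF page + 388): p. 392
(3.9) *«(D*F)(x, x + ηe_μ) = Σ_{ν<μ} η⁻¹(…) − Σ_{ν>μ} η⁻¹(…) = Σ_ν (D*_νF_{νμ})(x)»*, p. 399 (3.49), p. 414 (3.101)–(3.103).  The conjugation is the ROUTE's
Combes–Thomas substitute (road B8″); nothing of print's rate is asserted.

WHAT IS PROVED (sorry-free; proof lane — no `def`; [folklore] finite lattice calculus).  The cocurl of `B9Eq34CovCurlVector` is indexed by the ordered pairs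
`q = (μ < ν)` through `y`'s bond `(y, κ)`: `(D*F)(y,κ) = c·[Σ_{q : q₂ = κ}(S(y−e_{q₁},q₁)F(y−e_{q₁},q) − F(y,q)) − Σ_{q : q₁ = κ}(S(y−e_{q₂},q₂)F(y−e_{q₂},q) −
F(y,q))]`; weights `σ = e^{κχ}` on bonds (read at the base site), `ρ = e^{−κχ}` on plaquettes (read at the base site).
* §1 **`conj_covCoCurl_sub_apply`** — with `σρ = 1` the untransported `F(y,q)` terms cancel exactly and only the transported plaquettes based at `y − e_ν`
  survive, with the factors `σ(y)ρ(y−e_ν) − 1`; `conjExp_covCoCurl_sub_apply`.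
* §2 **`norm_conjExp_covCoCurl_sub_apply_le`** — `≤ 2‖c‖‖κ‖θM_T·(Σ_q ‖F(y−e_{q₁},q)‖ + Σ_q ‖F(y−e_{q₂},q)‖)` (the ordered-pair sums bounded by the
  full sums — crude but `η`-free); `sum_norm_sq_conjExp_covCoCurl_sub_le` — `Σ_b ‖·‖² ≤ 4(2‖c‖‖κ‖θM_T)²·d³·Σ_p ‖F(p)‖²`.
* §3 `L²` (uniform `c₀`): **`norm_conjExp_covCoCurlL2K_sub_le`** (`≤ 4‖c‖‖κ‖θM_T·d^{3∕2}·‖F‖`, written with `d·√d`) and the ABSTRACT-MAP form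
  **`norm_mulOp_covCoCurlL2K_sub_le`** (`S_B` on bond fields as `e^{κχ(b₋)}`, `S_P⁻¹` on plaquette fields as `e^{−κχ(p₀)}`).
HONEST SCOPE.  One (I4)-type letter, crude constant; nothing of [B9] Thm 3.1∕3.3∕3.11 asserted; «NE9 ⇐ the named binders»; NE9 NOT PRINTED ∕ NOT PROVED;
row WALLED ON A MODEL (O-NE9-1; #5 UNRULED); spine PROVED 0∕9; rung (B)+1 on a finite T⁴ — NOT infinite volume, NOT mass gap, NOT BetaPertH, NOT Clay.
HONEST DEPENDENCY: continuum YM on T⁴ ⇐ BetaPertH ∧ nine spine estimates (0/9 proved); BetaPertH ⇐ (D1) ∧ (D4) ∧ CAP+tail.  NEW file; nothing modified.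
Net new unproved facts: 0.
-/

noncomputable section

open scoped BigOperators
open Finset

namespace Literature.MathematicalPhysics.QuantumFieldTheory.Balaban1983to89.B9Eq3101ConjugationLettersCoCurl

open B4Sect5Torus (TSite)
open B9SectCLatticeCarrier (Bond DirPair bpos btgt shift unshift shift_unshift unshift_shift)
open B9Eq33CovDerivVector (shiftEquiv)
open B9Eq34CovCurlVector (covCoCurl covCoCurl_apply)
open B9Eq311L2Pairing (WL2)
open B11Eq103H1Complex (BondL2K)
open B9Eq310HessianOperator (PlaqL2K covCoCurlL2K equiv_covCoCurlL2K)
open B9Eq3101ConjugationLetters (norm_exp_sub_one_le_of_abs_le exp_mul_exp_neg_eq_one exp_mul_exp_neg_eq_exp_sub)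
open B9Eq3101ConjugationLettersChain (eq_symm_of_pointwise)

variable {d : ℕ} {Pd : Fin d → ℕ} {V : Type*} [NormedAddCommGroup V] [NormedSpace ℂ V]

/-! ## §1 The identity -/

/-- **IDENTITY (general weights)** for the cocurl (3.9): with `σ(y)ρ(y) = 1` the untransported `F(y,q)` terms cancel and
`σ(y)(D*(ρF))(y,κ) − (D*F)(y,κ) = c·[Σ_{q₂=κ}(σ(y)ρ(y−e_{q₁}) − 1)S(y−e_{q₁},q₁)F(y−e_{q₁},q) − Σ_{q₁=κ}(σ(y)ρ(y−e_{q₂}) − 1)S(y−e_{q₂},q₂)F(y−e_{q₂},q)]`.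
[folklore] [cite: Balaban1985BackgroundPropagators, (3.9) p.392, (3.101)–(3.103) p.414] -/
theorem conj_covCoCurl_sub_apply {σ ρ : TSite d Pd → ℂ} (hσρ : ∀ x, σ x * ρ x = 1) (c : ℂ) (S : Bond d Pd → V →ₗ[ℂ] V)
    (F : B9SectCLatticeCarrier.Plaq d Pd → V) (y : TSite d Pd) (κ : Fin d) :
    σ y • covCoCurl c S (fun p => ρ p.1 • F p) (y, κ) - covCoCurl c S F (y, κ) =
      c • ((∑ q ∈ univ.filter (fun q : DirPair d => q.1.2 = κ),
          (σ y * ρ (unshift q.1.1 y) - 1) • S (unshift q.1.1 y, q.1.1) (F (unshift q.1.1 y, q))) -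
        ∑ q ∈ univ.filter (fun q : DirPair d => q.1.1 = κ),
          (σ y * ρ (unshift q.1.2 y) - 1) • S (unshift q.1.2 y, q.1.2) (F (unshift q.1.2 y, q))) := by
  have h1 := hσρ y
  rw [covCoCurl_apply, covCoCurl_apply, smul_comm (σ y) c, ← smul_sub, smul_sub (σ y), Finset.smul_sum, Finset.smul_sum]
  congr 1
  rw [sub_sub_sub_comm, ← Finset.sum_sub_distrib, ← Finset.sum_sub_distrib]
  congr 1
  · refine Finset.sum_congr rfl fun q _ => ?_
    simp only [map_smul, smul_sub, smul_smul]
    match_scalars <;> first | ring1 | linear_combination h1 | linear_combination (-1 : ℂ) * h1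
  · refine Finset.sum_congr rfl fun q _ => ?_
    simp only [map_smul, smul_sub, smul_smul]
    match_scalars <;> first | ring1 | linear_combination h1 | linear_combination (-1 : ℂ) * h1

/-- **IDENTITY (exponential weights)** for the cocurl. [folklore] [cite: Balaban1985BackgroundPropagators, (3.9) p.392, (3.49) p.399] -/
theorem conjExp_covCoCurl_sub_apply (κc : ℂ) (χ : TSite d Pd → ℝ) (c : ℂ) (S : Bond d Pd → V →ₗ[ℂ] V)
    (F : B9SectCLatticeCarrier.Plaq d Pd → V) (y : TSite d Pd) (κ : Fin d) :
    Complex.exp (κc * (χ y : ℂ)) • covCoCurl c S (fun p => Complex.exp (-(κc * (χ p.1 : ℂ))) • F p) (y, κ) - covCoCurl c S F (y, κ) =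
      c • ((∑ q ∈ univ.filter (fun q : DirPair d => q.1.2 = κ),
          (Complex.exp (κc * ((χ y - χ (unshift q.1.1 y) : ℝ) : ℂ)) - 1) • S (unshift q.1.1 y, q.1.1) (F (unshift q.1.1 y, q))) -
        ∑ q ∈ univ.filter (fun q : DirPair d => q.1.1 = κ),
          (Complex.exp (κc * ((χ y - χ (unshift q.1.2 y) : ℝ) : ℂ)) - 1) • S (unshift q.1.2 y, q.1.2) (F (unshift q.1.2 y, q))) := by
  rw [conj_covCoCurl_sub_apply (exp_mul_exp_neg_eq_one κc χ) c S F y κ]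
  simp only [exp_mul_exp_neg_eq_exp_sub]

/-! ## §2 The pointwise and `ℓ²` bounds -/

/-- One transported term: `‖(e^{κ(χ(y)−χ(y−e_ν))} − 1)·S(y−e_ν,ν)v‖ ≤ 2‖κ‖θM_T‖v‖` (the increment of `χ` along the bond `(y−e_ν, ν)` is `≤ θ`). [folklore]
[cite: Balaban1985BackgroundPropagators, (3.101)–(3.103) p.414] -/
theorem norm_term_le {θ MT : ℝ} {S : Bond d Pd → V →ₗ[ℂ] V} (hS : ∀ b v, ‖S b v‖ ≤ MT * ‖v‖) {κc : ℂ} {χ : TSite d Pd → ℝ}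
    (hχ : ∀ b : Bond d Pd, |χ (bpos b) - χ (btgt b)| ≤ θ) (hwin : ‖κc‖ * θ ≤ 1) (y : TSite d Pd) (ν : Fin d) (v : V) :
    ‖(Complex.exp (κc * ((χ y - χ (unshift ν y) : ℝ) : ℂ)) - 1) • S (unshift ν y, ν) v‖ ≤ 2 * ‖κc‖ * θ * MT * ‖v‖ := by
  rw [norm_smul]
  have hinc : |χ y - χ (unshift ν y)| ≤ θ := by
    rw [abs_sub_comm]
    have h := hχ (unshift ν y, ν)
    simp only [bpos, btgt, shift_unshift] at h
    exact h
  have h1 : ‖Complex.exp (κc * ((χ y - χ (unshift ν y) : ℝ) : ℂ)) - 1‖ ≤ 2 * ‖κc‖ * θ := norm_exp_sub_one_le_of_abs_le hinc hwin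
  have h0 : 0 ≤ 2 * ‖κc‖ * θ := le_trans (norm_nonneg _) h1
  calc _ ≤ (2 * ‖κc‖ * θ) * (MT * ‖v‖) := mul_le_mul h1 (hS _ _) (norm_nonneg _) h0
    _ = 2 * ‖κc‖ * θ * MT * ‖v‖ := by ring

/-- **POINTWISE BOUND** for the cocurl (the ordered-pair sums bounded by the full sums over `q`):
`‖(e^{κχ} D* e^{−κχ} − D*)F (y,κ)‖ ≤ 2‖c‖‖κ‖θM_T·(Σ_q ‖F(y−e_{q₁},q)‖ + Σ_q ‖F(y−e_{q₂},q)‖)`. [folklore]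
[cite: Balaban1985BackgroundPropagators, (3.9) p.392, (3.49) p.399, (3.101)–(3.103) p.414] -/
theorem norm_conjExp_covCoCurl_sub_apply_le {θ MT : ℝ} (hθ : 0 ≤ θ) (hMT : 0 ≤ MT) {S : Bond d Pd → V →ₗ[ℂ] V}
    (hS : ∀ b v, ‖S b v‖ ≤ MT * ‖v‖) {κc : ℂ} {χ : TSite d Pd → ℝ} (hχ : ∀ b : Bond d Pd, |χ (bpos b) - χ (btgt b)| ≤ θ) (hwin : ‖κc‖ * θ ≤ 1)
    (c : ℂ) (F : B9SectCLatticeCarrier.Plaq d Pd → V) (y : TSite d Pd) (κ : Fin d) :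
    ‖Complex.exp (κc * (χ y : ℂ)) • covCoCurl c S (fun p => Complex.exp (-(κc * (χ p.1 : ℂ))) • F p) (y, κ) - covCoCurl c S F (y, κ)‖ ≤
      2 * ‖c‖ * ‖κc‖ * θ * MT * ((∑ q : DirPair d, ‖F (unshift q.1.1 y, q)‖) + ∑ q : DirPair d, ‖F (unshift q.1.2 y, q)‖) := by
  rw [conjExp_covCoCurl_sub_apply, norm_smul]
  set K' : ℝ := 2 * ‖κc‖ * θ * MT with hK'
  have hK'0 : 0 ≤ K' := by positivity
  have h1 : ‖∑ q ∈ univ.filter (fun q : DirPair d => q.1.2 = κ),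
      (Complex.exp (κc * ((χ y - χ (unshift q.1.1 y) : ℝ) : ℂ)) - 1) • S (unshift q.1.1 y, q.1.1) (F (unshift q.1.1 y, q))‖ ≤
      K' * ∑ q : DirPair d, ‖F (unshift q.1.1 y, q)‖ := by
    calc _ ≤ ∑ q ∈ univ.filter (fun q : DirPair d => q.1.2 = κ), K' * ‖F (unshift q.1.1 y, q)‖ :=
          (norm_sum_le _ _).trans (Finset.sum_le_sum fun q _ => norm_term_le hS hχ hwin y q.1.1 _)
      _ ≤ ∑ q : DirPair d, K' * ‖F (unshift q.1.1 y, q)‖ :=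
          Finset.sum_le_sum_of_subset_of_nonneg (Finset.filter_subset _ _) fun q _ _ => by positivity
      _ = K' * ∑ q : DirPair d, ‖F (unshift q.1.1 y, q)‖ := by rw [Finset.mul_sum]
  have h2 : ‖∑ q ∈ univ.filter (fun q : DirPair d => q.1.1 = κ),
      (Complex.exp (κc * ((χ y - χ (unshift q.1.2 y) : ℝ) : ℂ)) - 1) • S (unshift q.1.2 y, q.1.2) (F (unshift q.1.2 y, q))‖ ≤
      K' * ∑ q : DirPair d, ‖F (unshift q.1.2 y, q)‖ := by
    calc _ ≤ ∑ q ∈ univ.filter (fun q : DirPair d => q.1.1 = κ), K' * ‖F (unshift q.1.2 y, q)‖ :=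
          (norm_sum_le _ _).trans (Finset.sum_le_sum fun q _ => norm_term_le hS hχ hwin y q.1.2 _)
      _ ≤ ∑ q : DirPair d, K' * ‖F (unshift q.1.2 y, q)‖ :=
          Finset.sum_le_sum_of_subset_of_nonneg (Finset.filter_subset _ _) fun q _ _ => by positivity
      _ = K' * ∑ q : DirPair d, ‖F (unshift q.1.2 y, q)‖ := by rw [Finset.mul_sum]
  calc _ ≤ ‖c‖ * (K' * ∑ q : DirPair d, ‖F (unshift q.1.1 y, q)‖ + K' * ∑ q : DirPair d, ‖F (unshift q.1.2 y, q)‖) :=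
        mul_le_mul_of_nonneg_left ((norm_sub_le _ _).trans (add_le_add h1 h2)) (norm_nonneg c)
    _ = 2 * ‖c‖ * ‖κc‖ * θ * MT * ((∑ q : DirPair d, ‖F (unshift q.1.1 y, q)‖) + ∑ q : DirPair d, ‖F (unshift q.1.2 y, q)‖) := by
        rw [hK']; ring

/-- `|DirPair d| ≤ d²` (the ordered direction pairs of (3.4)∕(3.9) are a subtype of all pairs). [folklore] [cite: Balaban1985BackgroundPropagators, (3.9) p.392] -/
private theorem card_dirPair_le' : (Fintype.card (DirPair d) : ℝ) ≤ (d : ℝ) ^ 2 := by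
  have h : Fintype.card (DirPair d) ≤ Fintype.card (Fin d × Fin d) := Fintype.card_subtype_le _
  rw [Fintype.card_prod, Fintype.card_fin] at h
  calc (Fintype.card (DirPair d) : ℝ) ≤ ((d * d : ℕ) : ℝ) := by exact_mod_cast h
    _ = (d : ℝ) ^ 2 := by push_cast; ring

/-- COUNTING: `Σ_y Σ_q g(y−e_{q₁}, q) = Σ_p g(p)` and the same with `q₂` (each plaquette is based at `y − e_ν` for exactly one site `y`). [folklore]
[cite: Balaban1985BackgroundPropagators, (3.9) p.392] -/
theorem sum_site_pair_unshift_eq (g : B9SectCLatticeCarrier.Plaq d Pd → ℝ) (i : DirPair d → Fin d) :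
    ∑ y : TSite d Pd, ∑ q : DirPair d, g (unshift (i q) y, q) = ∑ p : B9SectCLatticeCarrier.Plaq d Pd, g p := by
  calc ∑ y : TSite d Pd, ∑ q : DirPair d, g (unshift (i q) y, q) = ∑ q : DirPair d, ∑ y : TSite d Pd, g (unshift (i q) y, q) := Finset.sum_comm
    _ = ∑ q : DirPair d, ∑ x : TSite d Pd, g (x, q) := Finset.sum_congr rfl fun q _ =>
        Fintype.sum_equiv (shiftEquiv (i q)).symm (fun y => g (unshift (i q) y, q)) (fun x => g (x, q)) (fun y => rfl)
    _ = ∑ x : TSite d Pd, ∑ q : DirPair d, g (x, q) := Finset.sum_comm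
    _ = ∑ p : B9SectCLatticeCarrier.Plaq d Pd, g p := by rw [Fintype.sum_prod_type]

/-- **`ℓ²` BOUND, function level:** `Σ_b ‖(e^{κχ} D* e^{−κχ} − D*)F (b)‖² ≤ 4(2‖c‖‖κ‖θM_T)²·d³·Σ_p ‖F(p)‖²`. [folklore]
[cite: Balaban1985BackgroundPropagators, (3.9) p.392, (3.49) p.399, (3.101)–(3.103) p.414] -/
theorem sum_norm_sq_conjExp_covCoCurl_sub_le {θ MT : ℝ} (hθ : 0 ≤ θ) (hMT : 0 ≤ MT) {S : Bond d Pd → V →ₗ[ℂ] V}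
    (hS : ∀ b v, ‖S b v‖ ≤ MT * ‖v‖) {κc : ℂ} {χ : TSite d Pd → ℝ} (hχ : ∀ b : Bond d Pd, |χ (bpos b) - χ (btgt b)| ≤ θ) (hwin : ‖κc‖ * θ ≤ 1)
    (c : ℂ) (F : B9SectCLatticeCarrier.Plaq d Pd → V) :
    ∑ b : Bond d Pd, ‖Complex.exp (κc * (χ b.1 : ℂ)) • covCoCurl c S (fun p => Complex.exp (-(κc * (χ p.1 : ℂ))) • F p) b - covCoCurl c S F b‖ ^ 2
      ≤ 4 * (2 * ‖c‖ * ‖κc‖ * θ * MT) ^ 2 * (d : ℝ) ^ 3 * ∑ p : B9SectCLatticeCarrier.Plaq d Pd, ‖F p‖ ^ 2 := by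
  set K : ℝ := 2 * ‖c‖ * ‖κc‖ * θ * MT with hK
  set N : ℝ := (Fintype.card (DirPair d) : ℝ) with hN
  -- abbreviations for the two full sums at a site
  set A : TSite d Pd → ℝ := fun y => ∑ q : DirPair d, ‖F (unshift q.1.1 y, q)‖ with hA
  set B : TSite d Pd → ℝ := fun y => ∑ q : DirPair d, ‖F (unshift q.1.2 y, q)‖ with hB
  have hpt : ∀ b : Bond d Pd, ‖Complex.exp (κc * (χ b.1 : ℂ)) • covCoCurl c S (fun p => Complex.exp (-(κc * (χ p.1 : ℂ))) • F p) b -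
      covCoCurl c S F b‖ ^ 2 ≤ 2 * K ^ 2 * (A b.1 ^ 2 + B b.1 ^ 2) := by
    rintro ⟨y, κ⟩
    have h := norm_conjExp_covCoCurl_sub_apply_le hθ hMT hS hχ hwin c F y κ
    have h0 : 0 ≤ K * (A y + B y) := (norm_nonneg _).trans h
    calc _ ≤ (K * (A y + B y)) ^ 2 := pow_le_pow_left₀ (norm_nonneg _) h 2
      _ ≤ 2 * K ^ 2 * (A y ^ 2 + B y ^ 2) := by nlinarith [sq_nonneg (A y - B y), sq_nonneg K]
  -- Cauchy–Schwarz over the pairs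
  have hcsA : ∀ y, A y ^ 2 ≤ N * ∑ q : DirPair d, ‖F (unshift q.1.1 y, q)‖ ^ 2 := fun y => by
    have h := sq_sum_le_card_mul_sum_sq (s := (univ : Finset (DirPair d))) (f := fun q => ‖F (unshift q.1.1 y, q)‖)
    rwa [Finset.card_univ] at h
  have hcsB : ∀ y, B y ^ 2 ≤ N * ∑ q : DirPair d, ‖F (unshift q.1.2 y, q)‖ ^ 2 := fun y => by
    have h := sq_sum_le_card_mul_sum_sq (s := (univ : Finset (DirPair d))) (f := fun q => ‖F (unshift q.1.2 y, q)‖)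
    rwa [Finset.card_univ] at h
  have hSA := sum_site_pair_unshift_eq (fun p => ‖F p‖ ^ 2) (fun q : DirPair d => q.1.1)
  have hSB := sum_site_pair_unshift_eq (fun p => ‖F p‖ ^ 2) (fun q : DirPair d => q.1.2)
  have hNle : N ≤ (d : ℝ) ^ 2 := card_dirPair_le'
  have hsum0 : 0 ≤ ∑ p : B9SectCLatticeCarrier.Plaq d Pd, ‖F p‖ ^ 2 := Finset.sum_nonneg fun p _ => sq_nonneg _
  calc _ ≤ ∑ b : Bond d Pd, 2 * K ^ 2 * (A b.1 ^ 2 + B b.1 ^ 2) := Finset.sum_le_sum fun b _ => hpt b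
    _ = d * ∑ y : TSite d Pd, 2 * K ^ 2 * (A y ^ 2 + B y ^ 2) := by
        rw [Fintype.sum_prod_type]
        simp only [Finset.sum_const, Finset.card_univ, Fintype.card_fin, nsmul_eq_mul]
        rw [Finset.mul_sum]
    _ ≤ d * ∑ y : TSite d Pd, 2 * K ^ 2 * (N * (∑ q : DirPair d, ‖F (unshift q.1.1 y, q)‖ ^ 2) + N * ∑ q : DirPair d, ‖F (unshift q.1.2 y, q)‖ ^ 2) := by
        gcongr with y
        · exact hcsA y
        · exact hcsB y
    _ = 2 * K ^ 2 * N * d * ((∑ y : TSite d Pd, ∑ q : DirPair d, ‖F (unshift q.1.1 y, q)‖ ^ 2) +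
          ∑ y : TSite d Pd, ∑ q : DirPair d, ‖F (unshift q.1.2 y, q)‖ ^ 2) := by
        rw [← Finset.sum_add_distrib]
        conv_rhs => rw [Finset.mul_sum]
        conv_lhs => rw [Finset.mul_sum]
        exact Finset.sum_congr rfl fun y _ => by ring
    _ = 4 * K ^ 2 * N * d * ∑ p : B9SectCLatticeCarrier.Plaq d Pd, ‖F p‖ ^ 2 := by rw [hSA, hSB]; ring
    _ ≤ 4 * K ^ 2 * (d : ℝ) ^ 2 * d * ∑ p : B9SectCLatticeCarrier.Plaq d Pd, ‖F p‖ ^ 2 := by gcongr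
    _ = 4 * K ^ 2 * (d : ℝ) ^ 3 * ∑ p : B9SectCLatticeCarrier.Plaq d Pd, ‖F p‖ ^ 2 := by ring

/-! ## §3 The letter on the weighted `L²` carriers -/

section L2

variable {W : Type*} [NormedAddCommGroup W] [InnerProductSpace ℂ W] {c₀ : ℝ} [Fact (0 < c₀)]

/-- **THE COCURL LETTER IN `L²`:** `‖e^{κχ}·D*(e^{−κχ}F) − D*F‖ ≤ 4‖c‖‖κ‖θ·M_T·(d·√d)·‖F‖` (`0 ≤ θ`, `0 ≤ M_T`, `‖κ‖θ ≤ 1`). [folklore]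
[cite: Balaban1985BackgroundPropagators, (3.9) p.392, (3.49) p.399, (3.101)–(3.103) p.414, (3.11) p.392] -/
theorem norm_conjExp_covCoCurlL2K_sub_le {θ MT : ℝ} (hθ : 0 ≤ θ) (hMT : 0 ≤ MT) {S : Bond d Pd → W →ₗ[ℂ] W}
    (hS : ∀ b v, ‖S b v‖ ≤ MT * ‖v‖) {κc : ℂ} {χ : TSite d Pd → ℝ} (hχ : ∀ b : Bond d Pd, |χ (bpos b) - χ (btgt b)| ≤ θ) (hwin : ‖κc‖ * θ ≤ 1)
    (c : ℂ) (F : PlaqL2K ℂ d Pd c₀ W) :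
    ‖(WL2.equiv ℂ (fun _ : Bond d Pd => c₀) W).symm
          (fun b => Complex.exp (κc * (χ b.1 : ℂ)) •
            WL2.equiv ℂ (fun _ : Bond d Pd => c₀) W
              (covCoCurlL2K ℂ c₀ c S ((WL2.equiv ℂ (fun _ : B9SectCLatticeCarrier.Plaq d Pd => c₀) W).symm
                fun p => Complex.exp (-(κc * (χ p.1 : ℂ))) • WL2.equiv ℂ (fun _ : B9SectCLatticeCarrier.Plaq d Pd => c₀) W F p)) b) -
        covCoCurlL2K ℂ c₀ c S F‖ ≤ 4 * ‖c‖ * ‖κc‖ * θ * MT * (d * Real.sqrt d) * ‖F‖ := by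
  set K : ℝ := 2 * ‖c‖ * ‖κc‖ * θ * MT with hK
  have hK0 : 0 ≤ K := by positivity
  have hc₀ : 0 < c₀ := Fact.out
  set G : B9SectCLatticeCarrier.Plaq d Pd → W := WL2.equiv ℂ (fun _ : B9SectCLatticeCarrier.Plaq d Pd => c₀) W F with hG
  have hsum := sum_norm_sq_conjExp_covCoCurl_sub_le hθ hMT hS hχ hwin c G
  have hd3 : (d : ℝ) ^ 3 = (d * Real.sqrt d) ^ 2 := by
    rw [mul_pow, Real.sq_sqrt (Nat.cast_nonneg d)]; ring
  have hsq : ‖(WL2.equiv ℂ (fun _ : Bond d Pd => c₀) W).symm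
          (fun b => Complex.exp (κc * (χ b.1 : ℂ)) •
            WL2.equiv ℂ (fun _ : Bond d Pd => c₀) W
              (covCoCurlL2K ℂ c₀ c S ((WL2.equiv ℂ (fun _ : B9SectCLatticeCarrier.Plaq d Pd => c₀) W).symm
                fun p => Complex.exp (-(κc * (χ p.1 : ℂ))) • WL2.equiv ℂ (fun _ : B9SectCLatticeCarrier.Plaq d Pd => c₀) W F p)) b) -
        covCoCurlL2K ℂ c₀ c S F‖ ^ 2 ≤ (2 * K * (d * Real.sqrt d) * ‖F‖) ^ 2 := by
    rw [WL2.norm_sq, mul_pow, mul_pow, mul_pow, ← hd3, WL2.norm_sq F]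
    have e : ∀ b : Bond d Pd,
        WL2.equiv ℂ (fun _ : Bond d Pd => c₀) W ((WL2.equiv ℂ (fun _ : Bond d Pd => c₀) W).symm
          (fun b => Complex.exp (κc * (χ b.1 : ℂ)) •
            WL2.equiv ℂ (fun _ : Bond d Pd => c₀) W
              (covCoCurlL2K ℂ c₀ c S ((WL2.equiv ℂ (fun _ : B9SectCLatticeCarrier.Plaq d Pd => c₀) W).symm
                fun p => Complex.exp (-(κc * (χ p.1 : ℂ))) • WL2.equiv ℂ (fun _ : B9SectCLatticeCarrier.Plaq d Pd => c₀) W F p)) b) -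
          covCoCurlL2K ℂ c₀ c S F) b =
        Complex.exp (κc * (χ b.1 : ℂ)) • covCoCurl c S (fun p => Complex.exp (-(κc * (χ p.1 : ℂ))) • G p) b - covCoCurl c S G b :=
      fun b => rfl
    simp only [e]
    rw [← mul_sum, ← mul_sum]
    calc c₀ * ∑ b : Bond d Pd, ‖Complex.exp (κc * (χ b.1 : ℂ)) • covCoCurl c S (fun p => Complex.exp (-(κc * (χ p.1 : ℂ))) • G p) b -
            covCoCurl c S G b‖ ^ 2
        ≤ c₀ * (4 * K ^ 2 * (d : ℝ) ^ 3 * ∑ p, ‖G p‖ ^ 2) := mul_le_mul_of_nonneg_left hsum hc₀.le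
      _ = 2 ^ 2 * K ^ 2 * (d : ℝ) ^ 3 * (c₀ * ∑ p, ‖G p‖ ^ 2) := by ring
  have hR0 : 0 ≤ 2 * K * (d * Real.sqrt d) * ‖F‖ := by positivity
  calc _ ≤ 2 * K * (d * Real.sqrt d) * ‖F‖ := (pow_le_pow_iff_left₀ (norm_nonneg _) hR0 two_ne_zero).1 hsq
    _ = 4 * ‖c‖ * ‖κc‖ * θ * MT * (d * Real.sqrt d) * ‖F‖ := by rw [hK]; ring

/-- **THE COCURL LETTER FOR ABSTRACT MAPS** `S_B` (bond fields, `e^{κχ(b₋)}`) and `S_P⁻¹` (plaquette fields, `e^{−κχ(p₀)}`):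
`‖S_B(D*(S_P⁻¹F)) − D*F‖ ≤ 4‖c‖‖κ‖θ·M_T·(d√d)·‖F‖`. [folklore] [cite: Balaban1985BackgroundPropagators, (3.9) p.392, (3.49) p.399] -/
theorem norm_mulOp_covCoCurlL2K_sub_le {θ MT : ℝ} (hθ : 0 ≤ θ) (hMT : 0 ≤ MT) {S : Bond d Pd → W →ₗ[ℂ] W}
    (hS : ∀ b v, ‖S b v‖ ≤ MT * ‖v‖) {κc : ℂ} {χ : TSite d Pd → ℝ} (hχ : ∀ b : Bond d Pd, |χ (bpos b) - χ (btgt b)| ≤ θ) (hwin : ‖κc‖ * θ ≤ 1)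
    (c : ℂ) (SB : BondL2K ℂ d Pd c₀ W → BondL2K ℂ d Pd c₀ W)
    (hSB : ∀ (A : BondL2K ℂ d Pd c₀ W) (b : Bond d Pd),
      WL2.equiv ℂ (fun _ : Bond d Pd => c₀) W (SB A) b = Complex.exp (κc * (χ b.1 : ℂ)) • WL2.equiv ℂ (fun _ : Bond d Pd => c₀) W A b)
    (SPinv : PlaqL2K ℂ d Pd c₀ W → PlaqL2K ℂ d Pd c₀ W)
    (hSPinv : ∀ (F : PlaqL2K ℂ d Pd c₀ W) (p : B9SectCLatticeCarrier.Plaq d Pd),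
      WL2.equiv ℂ (fun _ : B9SectCLatticeCarrier.Plaq d Pd => c₀) W (SPinv F) p =
        Complex.exp (-(κc * (χ p.1 : ℂ))) • WL2.equiv ℂ (fun _ : B9SectCLatticeCarrier.Plaq d Pd => c₀) W F p)
    (F : PlaqL2K ℂ d Pd c₀ W) :
    ‖SB (covCoCurlL2K ℂ c₀ c S (SPinv F)) - covCoCurlL2K ℂ c₀ c S F‖ ≤ 4 * ‖c‖ * ‖κc‖ * θ * MT * (d * Real.sqrt d) * ‖F‖ := by
  rw [eq_symm_of_pointwise SB _ hSB, eq_symm_of_pointwise SPinv _ hSPinv]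
  exact norm_conjExp_covCoCurlL2K_sub_le hθ hMT hS hχ hwin c F

end L2

end Literature.MathematicalPhysics.QuantumFieldTheory.Balaban1983to89.B9Eq3101ConjugationLettersCoCurl

end
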